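import Summits.CriticalPhenomena.PercolationContinuityZ3.Theorems.PercNearOneGluingNoHeavyLowerTailKnQuestion8CoefficientwiseComponentCube
import HarnessLib

/-!
# THEOREM CC: the disjoint-clusters form is nonnegative (coefficientwise first rung, prim-lf-2 gen 26)

Support file (`--supports stmt-CriticalPhenomena-4575`, closed), prover `prim-lf-2` (gen 26).  No definitions, no named facts, no sorries; standard axioms.
Memo `prim-lf-2/CW-REDUCTION-gen26.md` §13.

* `Coefficientwise.harris_twoColouring_subpowerset` — Harris in two-colouring form on the powerset of any finset (transport to the subtype);
* `Coefficientwise.cc_flip_sum_nonneg` — for a CC colouring `s` (red and blue clusters of `x` meet only in `x`), the sum of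
  `(f(K') − f(K̄'))(g(K') − g(K̄'))` over the `2^c` colourings obtained from `s` by flipping the edges at a set of components is `≥ 0`
  (it is a Harris sum over the component cube: `K' = {x} ∪ ⋃ (T ∆ J)`).
* `Coefficientwise.cc_sum_nonneg` — **THEOREM CC**: for monotone `f, g` and any weight `w ≥ 0` depending only on `U = K ∪ K̄`,
  `0 ≤ Σ_{s ⊆ E₀ : C_x(s) ∩ C_x(E₀∖s) = {x}} w(U) (f(C_x s) − f(C_x(E₀∖s)))(g(C_x s) − g(C_x(E₀∖s)))`
  (regroup the CC colourings into flip classes; each class is `2^{-c}` times a sum of the first kind).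
Used by `…CoefficientwiseApex.lean` (CW-PA(z) for every `z`-apex multigraph).
[cite: KozmaNitzan2024, Questions 8–9 (§5.5 p. 36) (context: first rung of the coefficientwise programme for Question 8)]
-/

namespace Summit.CriticalPhenomena.PercolationContinuityZ3.Theorems

open Finset Literature.Probability.Percolation
open scoped symmDiff

namespace Coefficientwise

variable {ι V : Type*} (ends : ι → Sym2 V) (E₀ : Finset ι) (x : V) (Vf : Finset V)

set_option quotPrecheck false in
/-- red cluster of `x` -/
local notation "K[" s "]" => openCluster (ends '' (↑(s : Finset ι) : Set ι)) x
set_option quotPrecheck false in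
/-- `U = K ∪ K̄` -/
local notation "U[" s "]" => (openCluster (ends '' (↑(s : Finset ι) : Set ι)) x ∪ openCluster (ends '' (↑(E₀ \ s : Finset ι) : Set ι)) x)
set_option quotPrecheck false in
/-- the component of `v` -/
local notation "Cmp[" s "," v "]" =>
  openCluster (ends '' (↑(E₀.filter (fun i => ∀ y ∈ ends i, y ∈ U[s] ∧ y ≠ x)) : Set ι)) v
set_option quotPrecheck false in
/-- the component of `v` as a finset -/
local notation "CmpF[" s "," v "]" => (Vf.filter (fun y : V => y ∈ Cmp[s, v]))
set_option quotPrecheck false in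
/-- the finset of components of `U \ {x}` -/
local notation "Comps[" s "]" => ((Vf.filter (fun v : V => v ∈ U[s] ∧ v ≠ x)).image (fun v : V => CmpF[s, v]))
set_option quotPrecheck false in
/-- the colouring flipped at the components `J` -/
local notation "FL[" s "," J "]" =>
  ((s : Finset ι) ∆ (@Finset.filter ι (fun i => ∃ w, w ∈ (↑((J : Finset (Finset V)).biUnion id) : Set V) ∧ w ∈ ends i)
    (fun _ => Classical.propDecidable _) E₀))
set_option quotPrecheck false in
/-- the first-rung summand -/
local notation "Φ[" f "," g "," s "]" =>
  (((f : Set V → ℝ) (K[s]) - f (K[E₀ \ s])) * ((g : Set V → ℝ) (K[s]) - g (K[E₀ \ s])))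

/-- Harris' inequality in two-colouring form on the powerset of an arbitrary finset (transport of `harris_twoColouring_powerset` to the subtype, so that no
`Fintype` instance on the ambient type is needed). [cite: KozmaNitzan2024, §5.5 (context: Harris 1960)] -/
theorem harris_twoColouring_subpowerset {α : Type*} [DecidableEq α] (Cs : Finset α) (F G : Finset α → ℝ) (hF : Monotone F) (hG : Monotone G) :
    0 ≤ ∑ A ∈ Cs.powerset, (F A - F (Cs \ A)) * (G A - G (Cs \ A)) := by
  classical
  set emb : {a // a ∈ Cs} ↪ α := Function.Embedding.subtype _ with hemb
  have hΦ : Monotone (fun t : Finset {a // a ∈ Cs} => F (t.map emb)) := fun t t' h => hF (Finset.map_subset_map.mpr h)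
  have hΨ : Monotone (fun t : Finset {a // a ∈ Cs} => G (t.map emb)) := fun t t' h => hG (Finset.map_subset_map.mpr h)
  have key := harris_twoColouring_powerset (Finset.univ : Finset {a // a ∈ Cs}) _ _ hΦ hΨ
  have map_compl : ∀ t : Finset {a // a ∈ Cs}, (Finset.univ \ t).map emb = Cs \ t.map emb := by
    intro t
    ext a
    simp only [Finset.mem_map, Finset.mem_sdiff, Finset.mem_univ, true_and, hemb, Function.Embedding.coe_subtype]
    constructor
    · rintro ⟨⟨b, hb⟩, hbt, rfl⟩
      exact ⟨hb, fun ⟨⟨c, hc⟩, hct, hcb⟩ => hbt (by cases hcb; exact hct)⟩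
    · rintro ⟨haC, hnot⟩
      exact ⟨⟨a, haC⟩, fun hat => hnot ⟨⟨a, haC⟩, hat, rfl⟩, rfl⟩
  have map_sub : ∀ t : Finset {a // a ∈ Cs}, t.map emb ⊆ Cs := by
    intro t a ha
    obtain ⟨⟨b, hb⟩, _, rfl⟩ := Finset.mem_map.mp ha
    exact hb
  refine key.trans_eq ?_
  refine Finset.sum_bij' (fun t _ => t.map emb) (fun A _ => A.subtype (· ∈ Cs)) ?_ ?_ ?_ ?_ ?_
  · intro t _
    exact Finset.mem_powerset.mpr (map_sub t)
  · intro A _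
    exact Finset.mem_powerset.mpr (Finset.subset_univ _)
  · intro t _
    ext ⟨a, ha⟩
    rw [Finset.mem_subtype, Finset.mem_map]
    constructor
    · rintro ⟨⟨b, hb⟩, hbt, hba⟩
      have hba' : b = a := by simpa [hemb] using hba
      subst hba'
      exact hbt
    · intro h
      exact ⟨⟨a, ha⟩, h, by simp [hemb]⟩
  · intro A hA
    have hsub : A ⊆ Cs := Finset.mem_powerset.mp hA
    ext a
    rw [Finset.mem_map]
    constructor
    · rintro ⟨⟨b, hb⟩, hbA, rfl⟩
      rw [Finset.mem_subtype] at hbA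
      simpa [hemb] using hbA
    · intro haA
      exact ⟨⟨a, hsub haA⟩, Finset.mem_subtype.mpr haA, by simp [hemb]⟩
  · intro t _
    simp only [map_compl]

open Classical in
/-- Pointwise step of THEOREM CC: the sum over the flip class of a CC colouring is a Harris sum over its component cube, hence `≥ 0`.
[cite: KozmaNitzan2024, §5.5 (context: Harris 1960 on the component cube)] -/
theorem cc_flip_sum_nonneg (hVf : ∀ i ∈ E₀, ∀ y ∈ ends i, y ∈ Vf) {s : Finset ι} (hs : s ⊆ E₀)
    (hCC : ∀ y, y ∈ K[s] → y ∈ K[E₀ \ s] → y = x) (f g : Set V → ℝ) (hf : Monotone f) (hg : Monotone g) :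
    0 ≤ ∑ J ∈ (Comps[s]).powerset, Φ[f, g, FL[s, J]] := by
  obtain ⟨Cs, hCs⟩ : ∃ Cs : Finset (Finset V), Cs = Comps[s] := ⟨_, rfl⟩
  obtain ⟨T, hT⟩ : ∃ T : Finset (Finset V), T = Cs.filter (fun C : Finset V => (↑C : Set V) ⊆ K[s]) := ⟨_, rfl⟩
  have hTsub : T ⊆ Cs := by rw [hT]; exact Finset.filter_subset _ _
  rw [← hCs]
  -- the clusters of a flipped colouring, as unions of components
  have hKflip : ∀ J ∈ Cs.powerset, K[FL[s, J]] = ↑(insert x ((T ∆ J).biUnion id)) ∧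
      K[E₀ \ FL[s, J]] = ↑(insert x ((Cs \ (T ∆ J)).biUnion id)) := by
    intro J hJ
    rw [Finset.mem_powerset, hCs] at hJ
    have hs' : FL[s, J] ⊆ E₀ := flip_subset ends E₀ (s := s) hs (↑(J.biUnion id) : Set V)
    have hCC' := cc_flip ends E₀ x Vf hVf (s := s) hs hCC (J := J) hJ (↑(J.biUnion id) : Set V) rfl
    have hside := side_flip_eq ends E₀ x Vf hVf (s := s) hs hCC (J := J) hJ (↑(J.biUnion id) : Set V) rfl
    have hcomps := comps_congr ends E₀ x Vf (s := s) (s' := FL[s, J]) (union_flip_eq ends E₀ x Vf hVf (s := s) hs hCC (J := J) hJ (↑(J.biUnion id) : Set V) rfl)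
    rw [hT, hCs]
    refine ⟨?_, ?_⟩
    · rw [openCluster_eq_biUnion_side ends E₀ x Vf hVf (s := FL[s, J]) hs' hCC', hside]
    · rw [openCluster_sdiff_eq_biUnion_side ends E₀ x Vf hVf (s := FL[s, J]) hs' hCC', hside, hcomps]
  -- rewrite the summand through the side sets and reindex `J ↦ T ∆ J`: a Harris sum over the component cube
  obtain ⟨F, hF⟩ : ∃ F : Finset (Finset V) → ℝ, F = fun A => f ↑(insert x (A.biUnion id)) := ⟨_, rfl⟩
  obtain ⟨G, hG⟩ : ∃ G : Finset (Finset V) → ℝ, G = fun A => g ↑(insert x (A.biUnion id)) := ⟨_, rfl⟩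
  have hmonoF : Monotone F := by
    intro A B hAB
    rw [hF]
    exact hf (Set.insert_subset_insert (Finset.coe_subset.mpr (Finset.biUnion_subset_biUnion_of_subset_left _ hAB)))
  have hmonoG : Monotone G := by
    intro A B hAB
    rw [hG]
    exact hg (Set.insert_subset_insert (Finset.coe_subset.mpr (Finset.biUnion_subset_biUnion_of_subset_left _ hAB)))
  have hreindex : ∑ J ∈ Cs.powerset, Φ[f, g, FL[s, J]] = ∑ A ∈ Cs.powerset, (F A - F (Cs \ A)) * (G A - G (Cs \ A)) := by
    refine Finset.sum_nbij' (fun J => T ∆ J) (fun A => T ∆ A) ?_ ?_ ?_ ?_ ?_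
    · intro J hJ
      rw [Finset.mem_powerset] at hJ ⊢
      intro C hC
      rw [Finset.mem_symmDiff] at hC
      rcases hC with ⟨hCT, -⟩ | ⟨hCJ, -⟩
      · exact hTsub hCT
      · exact hJ hCJ
    · intro A hA
      rw [Finset.mem_powerset] at hA ⊢
      intro C hC
      rw [Finset.mem_symmDiff] at hC
      rcases hC with ⟨hCT, -⟩ | ⟨hCA, -⟩
      · exact hTsub hCT
      · exact hA hCA
    · intro J _; exact symmDiff_symmDiff_cancel_left T J
    · intro A _; exact symmDiff_symmDiff_cancel_left T A
    · intro J hJ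
      obtain ⟨h1, h2⟩ := hKflip J hJ
      simp only [hF, hG, h1, h2, Finset.coe_insert]
  rw [hreindex]
  exact harris_twoColouring_subpowerset Cs F G hmonoF hmonoG

open Classical in
/-- **THEOREM CC** (prim-lf-2 gen 26, memo §13).  For monotone `f, g`, a weight `w ≥ 0` depending only on `U = K ∪ K̄`, and any finite multigraph,
`0 ≤ Σ_{s ⊆ E₀ : C_x(s) ∩ C_x(E₀ \ s) = {x}} w(U) (f(C_x s) − f(C_x(E₀ \ s)))(g(C_x s) − g(C_x(E₀ \ s)))`:
the disjoint-clusters kernel is a nonnegative combination of Harris kernels of component cubes.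
[cite: KozmaNitzan2024, Questions 8–9 (§5.5 p. 36) (context)] -/
theorem cc_sum_nonneg (hVf : ∀ i ∈ E₀, ∀ y ∈ ends i, y ∈ Vf) (w : Set V → ℝ) (hw : ∀ U, 0 ≤ w U)
    (f g : Set V → ℝ) (hf : Monotone f) (hg : Monotone g) :
    0 ≤ ∑ s ∈ E₀.powerset.filter (fun s => ∀ y, y ∈ K[s] → y ∈ K[E₀ \ s] → y = x), w (U[s]) * Φ[f, g, s] := by
  obtain ⟨P, hP⟩ : ∃ P : Finset (Finset ι), P = E₀.powerset.filter (fun s => ∀ y, y ∈ K[s] → y ∈ K[E₀ \ s] → y = x) := ⟨_, rfl⟩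
  rw [← hP]
  have memP : ∀ {s}, s ∈ P ↔ s ⊆ E₀ ∧ ∀ y, y ∈ K[s] → y ∈ K[E₀ \ s] → y = x := fun {s} => by
    rw [hP, Finset.mem_filter, Finset.mem_powerset]
  -- weights of the flip classes
  obtain ⟨h, hh⟩ : ∃ h : Finset ι → ℝ, h = fun s => w (U[s]) * ((2 : ℝ) ^ (Comps[s]).card)⁻¹ := ⟨_, rfl⟩
  -- facts about flips of members of `P`
  have hflipP : ∀ s ∈ P, ∀ J ∈ (Comps[s]).powerset, FL[s, J] ∈ P ∧ Comps[FL[s, J]] = Comps[s] ∧ U[FL[s, J]] = U[s] := by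
    intro s hs J hJ
    obtain ⟨hsE, hCC⟩ := memP.mp hs
    rw [Finset.mem_powerset] at hJ
    have hU := union_flip_eq ends E₀ x Vf hVf (s := s) hsE hCC (J := J) hJ (↑(J.biUnion id) : Set V) rfl
    exact ⟨memP.mpr ⟨flip_subset ends E₀ (s := s) hsE (↑(J.biUnion id) : Set V), cc_flip ends E₀ x Vf hVf (s := s) hsE hCC (J := J) hJ (↑(J.biUnion id) : Set V) rfl⟩,
      comps_congr ends E₀ x Vf (s := s) (s' := FL[s, J]) hU, hU⟩
  -- Step 1: each term, spread over its flip class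
  have hspread : ∑ s ∈ P, w (U[s]) * Φ[f, g, s] = ∑ d ∈ P.sigma (fun s => (Comps[s]).powerset), h d.1 * Φ[f, g, d.1] := by
    rw [Finset.sum_sigma]
    refine Finset.sum_congr rfl fun s _ => ?_
    dsimp only
    rw [Finset.sum_const, Finset.card_powerset, nsmul_eq_mul, hh]
    have h2 : ((2 : ℝ) ^ (Comps[s]).card) ≠ 0 := pow_ne_zero _ two_ne_zero
    push_cast
    field_simp
  have hh' : ∀ s ∈ P, ∀ J ∈ (Comps[s]).powerset, h (FL[s, J]) = h s := by
    intro s hs J hJ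
    obtain ⟨-, hcomps, hU⟩ := hflipP s hs J hJ
    rw [hh]
    dsimp only
    rw [hcomps, hU]
  -- Step 2: the involution `(s, J) ↦ (flip_J s, J)` on the index set
  have hinv : ∑ d ∈ P.sigma (fun s => (Comps[s]).powerset), h d.1 * Φ[f, g, d.1] =
      ∑ d ∈ P.sigma (fun s => (Comps[s]).powerset), h d.1 * Φ[f, g, FL[d.1, d.2]] := by
    refine Finset.sum_nbij' (fun d => ⟨FL[d.1, d.2], d.2⟩) (fun d => ⟨FL[d.1, d.2], d.2⟩) ?_ ?_ ?_ ?_ ?_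
    · rintro ⟨s, J⟩ hd
      rw [Finset.mem_sigma] at hd ⊢
      obtain ⟨hP1, hcomps, -⟩ := hflipP s hd.1 J hd.2
      exact ⟨hP1, by rw [hcomps]; exact hd.2⟩
    · rintro ⟨s, J⟩ hd
      rw [Finset.mem_sigma] at hd ⊢
      obtain ⟨hP1, hcomps, -⟩ := hflipP s hd.1 J hd.2
      exact ⟨hP1, by rw [hcomps]; exact hd.2⟩
    · rintro ⟨s, J⟩ _
      simp only [symmDiff_symmDiff_cancel_right]
    · rintro ⟨s, J⟩ _
      simp only [symmDiff_symmDiff_cancel_right]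
    · rintro ⟨s, J⟩ hd
      rw [Finset.mem_sigma] at hd
      dsimp only
      rw [hh' s hd.1 J hd.2, symmDiff_symmDiff_cancel_right]
  rw [hspread, hinv, Finset.sum_sigma]
  refine Finset.sum_nonneg fun s hs => ?_
  dsimp only
  rw [← Finset.mul_sum]
  obtain ⟨hsE, hCC⟩ := memP.mp hs
  refine mul_nonneg ?_ (cc_flip_sum_nonneg ends E₀ x Vf hVf (s := s) hsE hCC f g hf hg)
  rw [hh]
  exact mul_nonneg (hw _) (inv_nonneg.mpr (pow_nonneg zero_le_two _))

end Coefficientwise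

end Summit.CriticalPhenomena.PercolationContinuityZ3.Theorems
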